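/-
Copyright (c) 2026 the pub-hodgecm-mathlib formalisation cell (harness21).  Prover seat hodgecm-mathlib-K2Liu-p13 (g0), Track B «K2-LIT»,
#184♮ = hLiu418 = `stmt-HodgeConjecture-24832`; #42S payer road, organ S3 (LEAD F0P6-plan (g13) RULING «M-157l» (1); census-first 09:13:59Z), file S3-F3.
-/
import Summits.HodgeConjecture.HodgeConjecture.Theorems.K2LiuInvariantFunctionTensorDecomposition   -- ★ S3-F2 (⇒ BRICK 3 ⇒ BRICK 2)
import Summits.HodgeConjecture.HodgeConjecture.Theorems.K2LiuLocalDegPSLevelFinite                   -- ★ S3-F1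
import Summits.HodgeConjecture.HodgeConjecture.Theorems.K2LiuIwasawaDatumStdSmooth                   -- ★ Lemma K-f: `exists_isOpen_forall_mul_eq_of_isStd`
import HarnessLib

/-!
# Crux `HLiu418`, #42S payer road, organ S3, file S3-F3: A STANDARD SECTION IS, AT EVERY FINITE PLACE `v`, A FINITE SUM OF SECTIONS PURE AT `v`
# `f s h = Σᵢ aᵢ(h·ι_v(h_v)⁻¹) · bᵢ(h_v)` with `bᵢ` local Siegel sections of `I_v(s, χ_v)` of a common open level

Cell `hodgecm-mathlib`, crux item hLiu418 = `stmt-HodgeConjecture-24832`; squad K2 ∕ K2Liu; LEAD F0P6-plan (g13), co-dealer K2E5-plan (g6); prover K2Liu-p13 (g0).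
THEOREMS ONLY (no `def`, no instance, no notation, no named-fact hypothesis, no `sorry`); lane `--supports stmt-HodgeConjecture-24832 --as helper` (count-neutral).

THE ASSEMBLY of organ S3 at ONE place (the form U1-fin and the place-by-place sorting of #42S consume): for a STANDARD Iwasawa datum `𝒦` (★ `IsStd`), a `𝒦`-standard
family `f` (★ `IsStandardSectionFamily 𝒦 χ f`) with `f s` continuous, a parameter `s` and a finite place `v`:
* §1 the `v`-SLICES `u ↦ f s (x · ι_v u)` through `v`-trivial `x` are LOCAL SIEGEL SECTIONS for the character `siegelCharLoc χ v s` on `P_Δ(L⁺_v) = siegelDeltaLoc v`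
  (`slice_siegel_mul`: `x` commutes with `ι_v p`, ★ `commute_locToAdelic_of_evalPlace_eq_one`, and `f s` is a global Siegel section) and RIGHT-INVARIANT under the open
  `U_v := ι_v⁻¹(U)` where `U ≤ H(𝔸_f)` is the open level of Lemma K-f ★ `exists_isOpen_forall_mul_eq_of_isStd` (`slice_mul_level`);
* §2 **`exists_sum_pure_at_of_isStandardSectionFamily`**: there are an OPEN `U_v ≤ H_v`, `m`, local functions `bᵢ : H_v → ℂ` — each a Siegel section for
  `siegelCharLoc χ v s` and right-`U_v`-invariant (so `bᵢ ∈ I_v(s, χ_v)^{U_v}`) — and away-factors `aᵢ : H(𝔸) → ℂ` with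
  `f s h = Σᵢ aᵢ (h·ι_v(h_v)⁻¹) · bᵢ (h_v)` for all `h`.  PROOF: the slices lie in the subspace `W` of such local sections; `W` is FINITE-DIMENSIONAL by ★ S3-F1
  `finiteDimensional_localSections_of_iwasawa` with the Iwasawa compact `K₀ = pr_v C_f` of ★ BRICK 2 `exists_isStd_placeAdapted`; then ★ S3-F2 `exists_sum_mul_pure_at`.
No new literature: [BorelJacquet1979 §4.1 (admissibility, factorizable vectors)], [Flath1979 §2], [Tan1999 §1], [HarrisKudlaSweet1996 §1 (1.15)–(1.16)].
NEXT (S3-F4, after the S1 hand fixes the assembly face): iterate over the finite set `T` of non-spherical places and sort the `bᵢ` by S1's spanning face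
`I_v(½)^{sm} = R₂(V⁺_v) + R₂(V⁻_v)` into the collections of #42S.
HONEST LABEL.  Count-neutral helper: `HC_CM` is proved only modulo the 7 printed citations (2 remaining named inputs: hLiu418 = `stmt-HodgeConjecture-24832`,
h413 = `stmt-HodgeConjecture-24833`) until rung 0 closes.
-/

set_option autoImplicit false
set_option linter.dupNamespace false -- the mandated namespace repeats `HodgeConjecture.HodgeConjecture`

noncomputable section

open NumberField IsDedekindDomain
open scoped Matrix

namespace Summit.HodgeConjecture.HodgeConjecture.Cruxes.HLiu418.K2LiuKFiniteSectionPlaceDecomposition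

open Literature.NumberTheory.Automorphic hiding IsKFinite
open Literature.NumberTheory.GaloisRepresentations
open Literature.NumberTheory.GelbartRogawski1991 Literature.NumberTheory.GelbartRogawski1991.GRConstruction
open Literature.NumberTheory.K2Lit.SiegelDoubled
open Summit.HodgeConjecture.HodgeConjecture.Cruxes.HLiu418.K2LiuStdFamilyFactorisable (finPart_mul' archPart_locToAdelic evalPlace_finPart_locToAdelic_self)
open Summit.HodgeConjecture.HodgeConjecture.Cruxes.HLiu418.K2LiuIsStdPlaceAdapted (finPart_locToAdelic' exists_isStd_placeAdapted)
open Summit.HodgeConjecture.HodgeConjecture.Cruxes.HLiu418.K2LiuDoublingHeightQuasiFactorization (commute_locToAdelic_of_evalPlace_eq_one)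
open Summit.HodgeConjecture.HodgeConjecture.Cruxes.HLiu418.K2LiuLocalDegPSLevelFinite (finiteDimensional_localSections_of_iwasawa)
open Summit.HodgeConjecture.HodgeConjecture.Cruxes.HLiu418.K2LiuInvariantFunctionTensorDecomposition (exists_sum_mul_pure_at)
open Summit.HodgeConjecture.HodgeConjecture.Cruxes.HLiu418.K2LiuIwasawaDatumStdSmooth (exists_isOpen_forall_mul_eq_of_isStd)

variable {L : Type} [Field L] [NumberField L] [IsCMField L]
variable {N M n : ℕ} {e : Fin N × Fin M ≃ Fin n}
  {dV : Fin N → L} {hdV : ∀ i, IsCMField.complexConj L (dV i) = dV i}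
  {dW : Fin M → L} {hdW : ∀ i, IsCMField.complexConj L (dW i) = dW i}
variable (v : HeightOneSpectrum (𝓞 (Fp L)))

/-! ## §1 The `v`-slices of a global Siegel section: local Siegel sections of a common open level -/

/-- **the `v`-slice of a Siegel section through a `v`-trivial `x` is a local Siegel section**: `f (x · ι_v(p u)) = siegelCharLoc χ v s p · f (x · ι_v u)` for
`p ∈ P_Δ(L⁺_v)` (`x` commutes with `ι_v p`). [cite: Tan1999, §1 p. 166] [cite: HarrisKudlaSweet1996, §1 (1.15)] -/
theorem slice_siegel_mul {χ : HeckeCharacter L} {s : ℂ} {φ : HA L e dV hdV dW hdW → ℂ} (hφ : IsSiegelDeltaSection L e dV hdV dW hdW χ s φ)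
    {x : HA L e dV hdV dW hdW} (hx : UnitaryGroup.evalPlace (Fp L) L (IsCMField.complexConj L) (n + n) (hermD L e dV hdV dW hdW) v (UnitaryGroup.finPart (Fp L) L (IsCMField.complexConj L) (n + n) (hermD L e dV hdV dW hdW) x) = 1) {p : UnitaryGroup.localPi L (IsCMField.complexConj L) (n + n) (hermD L e dV hdV dW hdW) v} (hp : p ∈ siegelDeltaLoc L e dV hdV dW hdW v) (u : UnitaryGroup.localPi L (IsCMField.complexConj L) (n + n) (hermD L e dV hdV dW hdW) v) :
    φ (x * locToAdelic L e dV hdV dW hdW v (p * u)) = siegelCharLoc L e dV hdV dW hdW v χ s p * φ (x * locToAdelic L e dV hdV dW hdW v u) := by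
  have hιp : IsSiegelDelta L e dV hdV dW hdW (locToAdelic L e dV hdV dW hdW v p) := (mem_siegelDeltaLoc_iff L e dV hdV dW hdW v p).1 hp
  have hrew : x * locToAdelic L e dV hdV dW hdW v (p * u) = locToAdelic L e dV hdV dW hdW v p * (x * locToAdelic L e dV hdV dW hdW v u) := by
    rw [map_mul, ← mul_assoc, (commute_locToAdelic_of_evalPlace_eq_one L e dV hdV dW hdW v _ hx p).eq, mul_assoc]
  rw [hrew]
  exact hφ _ hιp _

/-- **the `v`-slices have the open level `U_v = ι_v⁻¹(U)`** when `φ` is right-invariant under `(1, U)`, `U ≤ H(𝔸_f)`. [cite: BorelJacquet1979, §4.1] -/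
theorem slice_mul_level {φ : HA L e dV hdV dW hdW → ℂ}
    {U : Subgroup (UnitaryGroup.finAdelic (Fp L) L (IsCMField.complexConj L) (n + n) (hermD L e dV hdV dW hdW))}
    (hU : ∀ k : HA L e dV hdV dW hdW, UnitaryGroup.archPart (Fp L) L (IsCMField.complexConj L) (n + n) (hermD L e dV hdV dW hdW) k = 1 → UnitaryGroup.finPart (Fp L) L (IsCMField.complexConj L) (n + n) (hermD L e dV hdV dW hdW) k ∈ U → ∀ h : HA L e dV hdV dW hdW, φ (h * k) = φ h)
    (x : HA L e dV hdV dW hdW) (u : UnitaryGroup.localPi L (IsCMField.complexConj L) (n + n) (hermD L e dV hdV dW hdW) v) {u' : UnitaryGroup.localPi L (IsCMField.complexConj L) (n + n) (hermD L e dV hdV dW hdW) v} (hu' : u' ∈ U.comap (UnitaryGroup.inclPlace (Fp L) L (IsCMField.complexConj L) (n + n) (hermD L e dV hdV dW hdW) v)) :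
    φ (x * locToAdelic L e dV hdV dW hdW v (u * u')) = φ (x * locToAdelic L e dV hdV dW hdW v u) := by
  rw [map_mul, ← mul_assoc]
  exact hU _ (archPart_locToAdelic L e dV hdV dW hdW v u') (by rw [finPart_locToAdelic']; exact hu') _

/-! ## §2 A standard section is a finite sum of sections pure at `v` -/

set_option maxHeartbeats 800000 in -- measured > 200 000: the `H(𝔸)`-vs-`(adelicGroupData …).Adelic` unifications of the component maps are expensive (cf. ★ BRICK 2∕3, ★ `K2LiuStdFamilyFactorisable`); `obtain`/`exact` only, no search tactics
/-- **A STANDARD SECTION IS, AT EVERY FINITE PLACE `v`, A FINITE SUM OF SECTIONS PURE AT `v`.**  For a standard Iwasawa datum `𝒦`, a `𝒦`-standard family `f` with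
`f s` continuous, a parameter `s` and a finite place `v`: there are an OPEN subgroup `U_v ≤ H_v`, `m ∈ ℕ`, local functions `bᵢ : H_v → ℂ` that are Siegel sections
for the local character `siegelCharLoc χ v s` on `P_Δ(L⁺_v)` and right-`U_v`-invariant, and functions `aᵢ : H(𝔸) → ℂ`, with
`f s h = Σᵢ aᵢ (h · ι_v(h_v)⁻¹) · bᵢ (h_v)` for every `h ∈ H(𝔸)`. [cite: BorelJacquet1979, §4.1] [cite: Flath1979, §2] [cite: Tan1999, §1 p. 166]
[cite: HarrisKudlaSweet1996, §1 (1.15)–(1.16)] -/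
theorem exists_sum_pure_at_of_isStandardSectionFamily {𝒦 : IwasawaDatum L e dV hdV dW hdW} (h𝒦 : 𝒦.IsStd) {χ : HeckeCharacter L}
    {f : ℂ → HA L e dV hdV dW hdW → ℂ} (hf : IsStandardSectionFamily 𝒦 χ f) (hfc : ∀ s, Continuous (f s)) (s : ℂ) :
    ∃ (Uv : Subgroup (UnitaryGroup.localPi L (IsCMField.complexConj L) (n + n) (hermD L e dV hdV dW hdW) v)) (m : ℕ) (b : Fin m → (UnitaryGroup.localPi L (IsCMField.complexConj L) (n + n) (hermD L e dV hdV dW hdW) v → ℂ)) (a : Fin m → (HA L e dV hdV dW hdW → ℂ)),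
      IsOpen (Uv : Set (UnitaryGroup.localPi L (IsCMField.complexConj L) (n + n) (hermD L e dV hdV dW hdW) v)) ∧
      (∀ i, (∀ p ∈ siegelDeltaLoc L e dV hdV dW hdW v, ∀ u : UnitaryGroup.localPi L (IsCMField.complexConj L) (n + n) (hermD L e dV hdV dW hdW) v, b i (p * u) = siegelCharLoc L e dV hdV dW hdW v χ s p * b i u) ∧
        ∀ u : UnitaryGroup.localPi L (IsCMField.complexConj L) (n + n) (hermD L e dV hdV dW hdW) v, ∀ u' ∈ Uv, b i (u * u') = b i u) ∧
      ∀ h : HA L e dV hdV dW hdW,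
        f s h = ∑ i, a i (h * (locToAdelic L e dV hdV dW hdW v (UnitaryGroup.evalPlace (Fp L) L (IsCMField.complexConj L) (n + n) (hermD L e dV hdV dW hdW) v (UnitaryGroup.finPart (Fp L) L (IsCMField.complexConj L) (n + n) (hermD L e dV hdV dW hdW) h)))⁻¹) * b i (UnitaryGroup.evalPlace (Fp L) L (IsCMField.complexConj L) (n + n) (hermD L e dV hdV dW hdW) v (UnitaryGroup.finPart (Fp L) L (IsCMField.complexConj L) (n + n) (hermD L e dV hdV dW hdW) h)) := by
  -- the open level of `f s` (Lemma K-f) and its trace `U_v` on `H_v`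
  obtain ⟨U, hUo, hU⟩ := exists_isOpen_forall_mul_eq_of_isStd h𝒦 (hf.2.1 s) (hfc s)
  have hUvo : IsOpen ((U.comap (UnitaryGroup.inclPlace (Fp L) L (IsCMField.complexConj L) (n + n) (hermD L e dV hdV dW hdW) v)) : Set (UnitaryGroup.localPi L (IsCMField.complexConj L) (n + n) (hermD L e dV hdV dW hdW) v)) := by
    rw [Subgroup.coe_comap]
    exact hUo.preimage (UnitaryGroup.continuous_inclPlace (Fp L) L (IsCMField.complexConj L) (n + n) (hermD L e dV hdV dW hdW) v)
  -- the Iwasawa compact `K₀ = pr_v C_f` of the `v`-adapted datum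
  obtain ⟨-, K₀, -, -, -, -, hK₀cpt, -, hIw, -, -⟩ := exists_isStd_placeAdapted h𝒦 v
  -- the subspace `W` of local Siegel sections of level `U_v`
  let W : Submodule ℂ (UnitaryGroup.localPi L (IsCMField.complexConj L) (n + n) (hermD L e dV hdV dW hdW) v → ℂ) :=
    { carrier := {g | (∀ p ∈ siegelDeltaLoc L e dV hdV dW hdW v, ∀ u : UnitaryGroup.localPi L (IsCMField.complexConj L) (n + n) (hermD L e dV hdV dW hdW) v, g (p * u) = siegelCharLoc L e dV hdV dW hdW v χ s p * g u) ∧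
        ∀ u : UnitaryGroup.localPi L (IsCMField.complexConj L) (n + n) (hermD L e dV hdV dW hdW) v, ∀ u' ∈ U.comap (UnitaryGroup.inclPlace (Fp L) L (IsCMField.complexConj L) (n + n) (hermD L e dV hdV dW hdW) v), g (u * u') = g u}
      add_mem' := by
        rintro g g' ⟨hg1, hg2⟩ ⟨hg1', hg2'⟩
        exact ⟨fun p hp u => by rw [Pi.add_apply, Pi.add_apply, hg1 p hp u, hg1' p hp u, mul_add],
          fun u u' hu' => by rw [Pi.add_apply, Pi.add_apply, hg2 u u' hu', hg2' u u' hu']⟩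
      zero_mem' := ⟨fun p _ u => by simp, fun u u' _ => rfl⟩
      smul_mem' := by
        rintro c g ⟨hg1, hg2⟩
        exact ⟨fun p hp u => by rw [Pi.smul_apply, Pi.smul_apply, hg1 p hp u, smul_eq_mul, smul_eq_mul, mul_left_comm],
          fun u u' hu' => by rw [Pi.smul_apply, Pi.smul_apply, hg2 u u' hu']⟩ }
  have hWmem : ∀ g : UnitaryGroup.localPi L (IsCMField.complexConj L) (n + n) (hermD L e dV hdV dW hdW) v → ℂ, g ∈ W ↔ (∀ p ∈ siegelDeltaLoc L e dV hdV dW hdW v, ∀ u : UnitaryGroup.localPi L (IsCMField.complexConj L) (n + n) (hermD L e dV hdV dW hdW) v, g (p * u) = siegelCharLoc L e dV hdV dW hdW v χ s p * g u) ∧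
      ∀ u : UnitaryGroup.localPi L (IsCMField.complexConj L) (n + n) (hermD L e dV hdV dW hdW) v, ∀ u' ∈ U.comap (UnitaryGroup.inclPlace (Fp L) L (IsCMField.complexConj L) (n + n) (hermD L e dV hdV dW hdW) v), g (u * u') = g u := fun g => Iff.rfl
  haveI : FiniteDimensional ℂ W :=
    finiteDimensional_localSections_of_iwasawa v hK₀cpt hIw hUvo (siegelCharLoc L e dV hdV dW hdW v χ s) W fun g hg => (hWmem g).1 hg
  -- every `v`-slice of `f s` lies in `W`
  have hslice : ∀ x : HA L e dV hdV dW hdW, UnitaryGroup.evalPlace (Fp L) L (IsCMField.complexConj L) (n + n) (hermD L e dV hdV dW hdW) v (UnitaryGroup.finPart (Fp L) L (IsCMField.complexConj L) (n + n) (hermD L e dV hdV dW hdW) x) = 1 → (fun u => f s (x * locToAdelic L e dV hdV dW hdW v u)) ∈ W := fun x hx =>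
    (hWmem _).2 ⟨fun p hp u => slice_siegel_mul v (hf.1.1 s) hx hp u, fun u u' hu' => slice_mul_level v (hU) x u hu'⟩
  obtain ⟨m, b, a, hb, hsum⟩ := exists_sum_mul_pure_at v W (f s) hslice
  exact ⟨U.comap (UnitaryGroup.inclPlace (Fp L) L (IsCMField.complexConj L) (n + n) (hermD L e dV hdV dW hdW) v), m, b, a, hUvo, fun i => (hWmem _).1 (hb i), hsum⟩

end Summit.HodgeConjecture.HodgeConjecture.Cruxes.HLiu418.K2LiuKFiniteSectionPlaceDecomposition

end
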